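import Mathlib
import Literature.Analysis.FluidPDE.Tao2016AveragedNS.ShiftSetCascadeFlows
import Summits.NavierStokesRegularity.NavierStokesRegularity.Theorems.TaoLadderRungTwoFlatCertificateGlueBootstrapOn
import HarnessLib

/-!
# Certificate glue on a shift set `𝕊`, XIX-e: DENSE OUTPUT — the per-component Lohner step with a TIME-RESOLVED hull:
  at every intermediate time `u ∈ [0,h]` the exact flow from the node lies in EVERY parallelepiped certified by the
  landing clauses AT `u` (same node data, step `u`), so READOUT steps get hulls as tight as the nodes
  (helper for items stmt-NavierStokesRegularity-22987 `FlatGapCertificatesV2` (crux K_A♭ of route TaoLadderRungTwoFlat)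
  and stmt-24295 K_A₂(64); cell harvest/h2-tao-ladder, p1 g15; referee finding A-66 (β) on the Lohner path)

Glue XIX / XIX-c / XIX-d certify a step with the hull = the origin-centred majorant ball — enough for trapping, useless
for the readout window where the branch consumer (glue XXII `read_of_mesh`) needs the readout clauses on the hull of every
step (referee c57/c59/c60, A-66 (β)). The abstract Lohner landing theorem of glue XVIII (`lohner_land_approx`) holds for
ANY step length: applied at an intermediate time `u ≤ h` to the same solution it lands `ψ(u)` in the parallelepiped
`x''+ Cn'' ξ' + e'` of any data `(x'', Cn'', Cin'', r'', dP'', NVh'', κI'', E₁'')` satisfying the landing clauses AT `u`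
(`LandingClausesAt`; e.g. `x'' = TPoly_u(x)` exactly, trivial frame `Cn'' = Cin'' = 1`, `r''` = row sums of `|V_u C| r`,
on a subdivision of `[0,h]` with interval-in-`u` evaluation — the checker's business). Hence:

* `TubeL` — the time-resolved tube: majorant ball ∧ membership in every parallelepiped certified at `u`;
* `plohner_flow_dense` — the exact flow from `PInPara x C r E₀` lies in `TubeL u` for all `u ∈ [0,h]` and lands in
  `PInPara x' Cn r' E₁`;
* `stepCert_of_plohner_dense` — `StepCert j` with `Hull j ⊇ ⋃_u (TubeL u ⊕ A·ω)` (the user discharges `hH` on readout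
  steps from the parallelepipeds, on transit steps from the ball), bootstrap region `R ≥ R_h + A'` as in glue XIX-d.

HONEST FRAMING: Tao-type MODEL lattices (Tao 2016 §4/§6 vocabulary, shift-set parametrised); every clause is a
HYPOTHESIS — nothing is computed or certified here, no stub is closed, nothing about the Navier–Stokes equations.
-/

noncomputable section

-- the sub-problem namespace repeats the summit name by design (D-0017)
set_option linter.dupNamespace false

namespace Summit.NavierStokesRegularity.NavierStokesRegularity.Theorems

open Set Filter Topology Literature.Analysis.FluidPDE Literature.Analysis.FluidPDE.TaoCascade
open Summit.NavierStokesRegularity.NavierStokesRegularity.Theorems.TaylorModelReadout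

namespace CertificateGlueOn

variable {m : ℕ} {Kb Ka : ℤ} {ω : Fin m → ℤ → ℝ}
  {𝕊 : Finset (ℤ × ℤ × ℤ)} {ε₀ : ℝ} {α : Fin m → Fin m → Fin m → ℤ × ℤ × ℤ → ℝ} {Eb Et : ℝ}

/-- **THE LANDING CLAUSES AT STEP LENGTH `u`** of the abstract Lohner step (glue XVIII `lohner_land_approx`) for the
field `Q`, degree `p`, node `(x, C, r)` with bounds `(b, mC, ρC, E₀)` and candidate landing data
`(x'', Cn'', Cin'', r'', dP'', NVh'', κI'', E₁'')`: centre defect, variational bound, frame transport, approximate inverse,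
E-recursion — the finite clauses a checker verifies (at `u = h` for the node hand-over, at intermediate `u` for dense
output). [cite: Zgliczynski2002C1Lohner, §3–4 (Lohner-type parallelepiped frames and the C¹/variational enclosure); cell certificate format, Lohner step] -/
def LandingClausesAt {n : ℕ} (Q : (Fin n → ℝ) → (Fin n → ℝ) → Fin n → ℝ) (p : ℕ) (b mC ρC E₀ : ℝ) (x : Fin n → ℝ)
    (C : Matrix (Fin n) (Fin n) ℝ) (r : Fin n → ℝ) (u : ℝ) (x'' : Fin n → ℝ) (Cn'' Cin'' : Matrix (Fin n) (Fin n) ℝ)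
    (r'' : Fin n → ℝ) (dP'' NVh'' κI'' E₁'' : ℝ) : Prop :=
  (∀ c, |TPoly Q p x u c - x'' c| ≤ dP'') ∧
  (∀ (v : Fin n → ℝ) (N : ℝ), 0 ≤ N → (∀ c, |v c| ≤ N) → ∀ c, |VPoly Q p x v u c| ≤ NVh'' * N) ∧
  (∀ ξ : Fin n → ℝ, (∀ c, |ξ c| ≤ r c) → ∀ c, |Cin''.mulVec (VPoly Q p x (C.mulVec ξ) u) c| ≤ r'' c) ∧
  (∀ ξ : Fin n → ℝ, (∀ c, |ξ c| ≤ r c) → ∀ c,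
    |(Cn''.mulVec (Cin''.mulVec (VPoly Q p x (C.mulVec ξ) u)) - VPoly Q p x (C.mulVec ξ) u) c| ≤ κI'') ∧
  (κI'' + dP'' + NVh'' * E₀ + mC * (b * mC * u) ^ (p + 1) / (1 - b * mC * u) +
      (ρC + E₀) * ((((p : ℝ) + 2) * (b * mC * u) ^ (p + 1) - ((p : ℝ) + 1) * (b * mC * u) ^ (p + 2)) /
        (1 - b * mC * u) ^ 2) +
      ((mC + (ρC + E₀)) / (1 - b * (mC + (ρC + E₀)) * u) - mC / (1 - b * mC * u) -
        (ρC + E₀) / (1 - b * mC * u) ^ 2) ≤ E₁'')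

/-- **THE TIME-RESOLVED TUBE** of a per-component Lohner step at time `u`: the majorant ball of radius `R_h` AND every
parallelepiped `PInPara x'' Cn'' r'' E₁''` whose data satisfy the landing clauses at `u`.
[cite: Zgliczynski2002C1Lohner, §3–4 (Lohner-type parallelepiped frames); cell certificate format, Lohner step, dense output] -/
def TubeL (𝕊 : Finset (ℤ × ℤ × ℤ)) (ε₀ : ℝ) (α : Fin m → Fin m → Fin m → ℤ × ℤ × ℤ → ℝ) (Kb Ka : ℤ)
    (ω : Fin m → ℤ → ℝ) (p : ℕ) (b mC ρC E₀ Rh : ℝ) (x : Fin (m * winLen Kb Ka) → ℝ)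
    (C : Matrix (Fin (m * winLen Kb Ka)) (Fin (m * winLen Kb Ka)) ℝ) (r : Fin (m * winLen Kb Ka) → ℝ)
    (u : ℝ) (q : Fin m → ℤ → ℝ) : Prop :=
  (∀ i k, -Kb ≤ k → k ≤ Ka → |q i k| ≤ Rh * ω i k) ∧
  ∀ (x'' : Fin (m * winLen Kb Ka) → ℝ) (Cn'' Cin'' : Matrix (Fin (m * winLen Kb Ka)) (Fin (m * winLen Kb Ka)) ℝ)
    (r'' : Fin (m * winLen Kb Ka) → ℝ) (dP'' NVh'' κI'' E₁'' : ℝ),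
    LandingClausesAt (PQcN 𝕊 ε₀ α Kb Ka ω) p b mC ρC E₀ x C r u x'' Cn'' Cin'' r'' dP'' NVh'' κI'' E₁'' →
      PInPara Kb Ka ω x'' Cn'' r'' E₁'' q

/-- **The exact flow of a per-component Lohner step lies in the time-resolved tube** at every `u ∈ [0,h]` and lands in
the parallelepiped certified at `h`. [cite: Zgliczynski2002C1Lohner, §3–4 (Lohner-type parallelepiped frames and the C¹/variational enclosure); cell certificate format, Lohner step, dense output] -/
theorem plohner_flow_dense (hKb : 0 ≤ Kb) (hKa : 1 ≤ Ka) (hε : 0 < 1 + ε₀) (hω : ∀ i k, 0 < ω i k)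
    {p : ℕ} {h b mC ρC E₀ E₁ dP NVh κI : ℝ} {x x' : Fin (m * winLen Kb Ka) → ℝ}
    {C Cn Cin : Matrix (Fin (m * winLen Kb Ka)) (Fin (m * winLen Kb Ka)) ℝ} {r r' : Fin (m * winLen Kb Ka) → ℝ}
    (hb : 0 ≤ b) (hmC : 0 ≤ mC) (hρC : 0 ≤ ρC) (hE₀ : 0 ≤ E₀) (hh : 0 ≤ h) (hguard : b * (mC + (ρC + E₀)) * h < 1)
    (hB : ∀ i k, -Kb ≤ k → k ≤ Ka →
      ∑ i₁ : Fin m, ∑ i₂ : Fin m, ∑ μ ∈ 𝕊,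
        |α i₁ i₂ i μ| * (1 + ε₀) ^ ((5 : ℝ) * (k - μ.2.2) / 2) *
          (pwExt Kb Ka ω i₁ (k - μ.2.2 + μ.1) * pwExt Kb Ka ω i₂ (k - μ.2.2 + μ.2.1)) ≤ b * ω i k)
    (hx : ∀ c, |x c| ≤ mC)
    (hC : ∀ ξ : Fin (m * winLen Kb Ka) → ℝ, (∀ c, |ξ c| ≤ r c) → ∀ c, |C.mulVec ξ c| ≤ ρC)
    (hclauses : LandingClausesAt (PQcN 𝕊 ε₀ α Kb Ka ω) p b mC ρC E₀ x C r h x' Cn Cin r' dP NVh κI E₁) :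
    ∀ z : Fin m → ℤ → ℝ, PInPara Kb Ka ω x C r E₀ z → ∃ ψ : Fin m → ℤ → ℝ → ℝ,
      (∀ i k, -Kb ≤ k → k ≤ Ka → ψ i k 0 = z i k) ∧
      (∀ i k, -Kb ≤ k → k ≤ Ka → ∀ u ∈ Icc 0 h,
        HasDerivWithinAt (ψ i k) (truncField 𝕊 ε₀ α Kb Ka (slice ψ u) i k) (Icc 0 h) u) ∧
      (∀ u ∈ Icc 0 h, TubeL 𝕊 ε₀ α Kb Ka ω p b mC ρC E₀ ((mC + (ρC + E₀)) / (1 - b * (mC + (ρC + E₀)) * h))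
        x C r u (slice ψ u)) ∧
      PInPara Kb Ka ω x' Cn r' E₁ (slice ψ h) := by
  have hKK : 0 ≤ Ka + Kb + 1 := by omega
  set ρ := ρC + E₀ with hρdef
  have hρ0 : 0 ≤ ρ := by positivity
  set Rh := (mC + ρ) / (1 - b * (mC + ρ) * h) with hRh
  have hden : 0 < 1 - b * (mC + ρ) * h := by linarith
  set Q := PQcN 𝕊 ε₀ α Kb Ka ω with hQ
  have hBQ := pqcN_bound_of_table (𝕊 := 𝕊) (ε₀ := ε₀) (α := α) hε hω hKK hB
  have hQl : ∀ u, IsLinearMap ℝ (Q u) := isLinearMap_PQcN_right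
  have hQr : ∀ v, IsLinearMap ℝ (fun u => Q u v) := isLinearMap_PQcN_left
  have hmaj : ∀ u ∈ Icc 0 h, (mC + ρ) / (1 - b * (mC + ρ) * u) ≤ Rh := by
    intro u hu
    exact div_le_div_of_nonneg_left (by positivity) hden (by nlinarith [mul_nonneg hb (add_nonneg hmC hρ0), hu.2])
  -- landing at any step length `u ≤ h` from the clauses at `u`
  have hlandAt : ∀ u ∈ Icc 0 h, ∀ (x'' : Fin (m * winLen Kb Ka) → ℝ)
      (Cn'' Cin'' : Matrix (Fin (m * winLen Kb Ka)) (Fin (m * winLen Kb Ka)) ℝ) (r'' : Fin (m * winLen Kb Ka) → ℝ)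
      (dP'' NVh'' κI'' E₁'' : ℝ), LandingClausesAt Q p b mC ρC E₀ x C r u x'' Cn'' Cin'' r'' dP'' NVh'' κI'' E₁'' →
      ∀ (ξ e : Fin (m * winLen Kb Ka) → ℝ), (∀ c, |ξ c| ≤ r c) → (∀ c, |e c| ≤ E₀) →
        ∀ ψ : ℝ → Fin (m * winLen Kb Ka) → ℝ, ψ 0 = x + (C.mulVec ξ + e) →
          (∀ s ∈ Icc 0 u, HasDerivWithinAt ψ (Q (ψ s) (ψ s)) (Icc 0 u) s) →
            ∃ ξ' e' : Fin (m * winLen Kb Ka) → ℝ, (∀ c, |ξ' c| ≤ r'' c) ∧ (∀ c, |e' c| ≤ E₁'') ∧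
              ψ u = x'' + (Cn''.mulVec ξ' + e') := by
    intro u hu x'' Cn'' Cin'' r'' dP'' NVh'' κI'' E₁'' hcl
    obtain ⟨h1, h2, h3, h4, h5⟩ := hcl
    have hgu : b * (mC + (ρC + E₀)) * u < 1 :=
      lt_of_le_of_lt (by nlinarith [mul_nonneg hb (add_nonneg hmC hρ0), hu.2]) hguard
    exact lohner_land_approx hQl hQr hb hBQ hu.1 hmC hρC hE₀ hx hgu hC h1 h2 h3 h4 h5
  intro z hz
  obtain ⟨ξ, e, hξ, he, hze⟩ := hz
  set v := C.mulVec ξ + e with hvdef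
  have hv : ∀ c, |v c| ≤ ρ := fun c => (abs_add_le _ _).trans (add_le_add (hC ξ hξ c) (he c))
  obtain ⟨ψ, hψ0, hψd, hψb⟩ := lohner_exists hQl hQr hb hBQ hh hmC hρ0 hx hguard v hv
  have hstart : (ψ 0) ∘ finProdFinEquiv = pwcoord Kb Ka ω z := by
    rw [hψ0, ← hze]; funext c; simp [pxcoord]
  have hsl : ∀ u, slice (fun i k u => pwstate Kb Ka ω ((ψ u) ∘ finProdFinEquiv) i k) u =
      pwstate Kb Ka ω ((ψ u) ∘ finProdFinEquiv) := fun u => by funext i' k'; rfl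
  refine ⟨fun i k u => pwstate Kb Ka ω ((ψ u) ∘ finProdFinEquiv) i k, fun i k hk1 hk2 => ?_,
    fun i k hk1 hk2 u hu => ?_, fun u hu => ⟨fun i k hk1 hk2 => ?_, ?_⟩, ?_⟩
  · -- start
    show pwstate Kb Ka ω ((ψ 0) ∘ finProdFinEquiv) i k = z i k
    rw [hstart, pwstate_pwcoord hω z i hk1 hk2]
  · -- the window equation (as in glue XIX-c)
    have hlt : (k + Kb).toNat < winLen Kb Ka := by
      unfold winLen; rw [Int.toNat_lt_toNat (by omega)]; omega
    set c : Fin (winLen Kb Ka) := ⟨(k + Kb).toNat, hlt⟩ with hc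
    have hsh : shellAt Kb c = k := by
      simp only [shellAt, hc]; rw [Int.toNat_of_nonneg (by omega)]; ring
    have hfun : (fun u => pwstate Kb Ka ω ((ψ u) ∘ finProdFinEquiv) i k) =
        fun u => ω i k * ψ u (finProdFinEquiv (i, c)) := by
      funext u
      have := pwstate_on (ω := ω) ((ψ u) ∘ finProdFinEquiv) hKK i c
      rw [hsh] at this
      simpa using this
    dsimp only
    rw [hfun]
    have hd := (hasDerivWithinAt_pi.1 (hψd u hu) (finProdFinEquiv (i, c))).const_mul (ω i k)
    refine hd.congr_deriv ?_
    rw [hsl u, truncField_eq_biFieldOn]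
    have hQapp : Q (ψ u) (ψ u) (finProdFinEquiv (i, c)) =
        biFieldOn 𝕊 ε₀ α Kb Ka (pwstate Kb Ka ω ((ψ u) ∘ finProdFinEquiv))
          (pwstate Kb Ka ω ((ψ u) ∘ finProdFinEquiv)) i k / ω i k := by
      simp only [hQ, PQcN, PQc, Equiv.symm_apply_apply, pwcoord]
      rw [hsh]
    rw [hQapp]
    field_simp [(hω i k).ne']
  · -- the majorant ball
    have hlt : (k + Kb).toNat < winLen Kb Ka := by
      unfold winLen; rw [Int.toNat_lt_toNat (by omega)]; omega
    set c : Fin (winLen Kb Ka) := ⟨(k + Kb).toNat, hlt⟩ with hc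
    have hsh : shellAt Kb c = k := by
      simp only [shellAt, hc]; rw [Int.toNat_of_nonneg (by omega)]; ring
    have hvb := hψb u hu (finProdFinEquiv (i, c))
    have := pwstate_on (ω := ω) ((ψ u) ∘ finProdFinEquiv) hKK i c
    rw [hsh] at this
    simp only [slice_apply]
    rw [this, abs_mul, abs_of_pos (hω i k), mul_comm]
    exact mul_le_mul_of_nonneg_right ((by simpa using hvb : |ψ u (finProdFinEquiv (i, c))| ≤ _).trans
      (hmaj u hu)) (hω i k).le
  · -- every parallelepiped certified at `u`
    intro x'' Cn'' Cin'' r'' dP'' NVh'' κI'' E₁'' hcl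
    rw [hsl u]
    exact pinPara_of_coords hω hKK (hlandAt u hu x'' Cn'' Cin'' r'' dP'' NVh'' κI'' E₁'' hcl ξ e hξ he ψ hψ0
      (fun s hs => (hψd s ⟨hs.1, hs.2.trans hu.2⟩).mono (Icc_subset_Icc_right hu.2)))
  · -- landing at `h`
    rw [hsl h]
    exact pinPara_of_coords hω hKK (hlandAt h ⟨hh, le_rfl⟩ x' Cn Cin r' dP NVh κI E₁ hclauses ξ e hξ he ψ hψ0 hψd)

/-- **`StepCert` FROM A PER-COMPONENT LOHNER STEP WITH DENSE OUTPUT AND A BOOTSTRAP REGION**: as glue XIX-d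
`stepCert_of_plohner_local_approx`, with the landing clauses bundled as `LandingClausesAt … h …` and the hull
hypothesis weakened to the TIME-RESOLVED tube `TubeL u` (majorant ball ∧ every parallelepiped certified at `u`) fattened
by `A·ω`. [cite: Zgliczynski2002C1Lohner, §3–4 (Lohner-type parallelepiped frames and the C¹/variational enclosure); cell certificate format, Lohner step, dense output] -/
theorem stepCert_of_plohner_dense (hKb : 0 ≤ Kb) (hKa : 1 ≤ Ka) (hε : 0 < 1 + ε₀) (hω : ∀ i k, 0 < ω i k)
    {M : ℤ → ℝ} {t : ℕ → ℝ} {Node Hull : ℕ → (Fin m → ℤ → ℝ) → Prop} {j p : ℕ}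
    {b mC ρC E₀ E₁ dP NVh κI R δ A A' : ℝ} {x x' : Fin (m * winLen Kb Ka) → ℝ}
    {C Cn Cin : Matrix (Fin (m * winLen Kb Ka)) (Fin (m * winLen Kb Ka)) ℝ} {r r' : Fin (m * winLen Kb Ka) → ℝ}
    (hb : 0 ≤ b) (hmC : 0 ≤ mC) (hρC : 0 ≤ ρC) (hE₀ : 0 ≤ E₀) (hδ : 0 ≤ δ) (hAA' : A < A')
    (hh : 0 ≤ t (j + 1) - t j) (hguard : b * (mC + (ρC + E₀)) * (t (j + 1) - t j) < 1)
    (hB : ∀ i k, -Kb ≤ k → k ≤ Ka →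
      ∑ i₁ : Fin m, ∑ i₂ : Fin m, ∑ μ ∈ 𝕊,
        |α i₁ i₂ i μ| * (1 + ε₀) ^ ((5 : ℝ) * (k - μ.2.2) / 2) *
          (pwExt Kb Ka ω i₁ (k - μ.2.2 + μ.1) * pwExt Kb Ka ω i₂ (k - μ.2.2 + μ.2.1)) ≤ b * ω i k)
    (hx : ∀ c, |x c| ≤ mC)
    (hC : ∀ ξ : Fin (m * winLen Kb Ka) → ℝ, (∀ c, |ξ c| ≤ r c) → ∀ c, |C.mulVec ξ c| ≤ ρC)
    (hclauses : LandingClausesAt (PQcN 𝕊 ε₀ α Kb Ka ω) p b mC ρC E₀ x C r (t (j + 1) - t j)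
      x' Cn Cin r' dP NVh κI E₁)
    (hR : (mC + (ρC + E₀)) / (1 - b * (mC + (ρC + E₀)) * (t (j + 1) - t j)) + A' ≤ R)
    (hdef : PInputDefectOn 𝕊 ε₀ α Kb Ka Eb Et ω (fun i k => -(R * ω i k)) (fun i k => R * ω i k) δ)
    (hA : gronwallBound 0 (2 * b * R) δ (t (j + 1) - t j) ≤ A)
    (hN : ∀ y, Node j y → PInPara Kb Ka ω x C r E₀ y)
    (hH : ∀ u ∈ Icc 0 (t (j + 1) - t j), ∀ y q : Fin m → ℤ → ℝ,
      TubeL 𝕊 ε₀ α Kb Ka ω p b mC ρC E₀ ((mC + (ρC + E₀)) / (1 - b * (mC + (ρC + E₀)) * (t (j + 1) - t j)))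
        x C r u q → (∀ i k, -Kb ≤ k → k ≤ Ka → |y i k - q i k| ≤ A * ω i k) → Hull j y)
    (hN' : ∀ y, PInPara Kb Ka ω x' Cn r' (E₁ + A) y → Node (j + 1) y) :
    StepCert 𝕊 ε₀ α Kb Ka Eb Et M t Node Hull j := by
  have hKK : 0 ≤ Ka + Kb + 1 := by omega
  set h := t (j + 1) - t j with hhdef
  set ρ := ρC + E₀ with hρdef
  have hρ0 : 0 ≤ ρ := by positivity
  set Rh := (mC + ρ) / (1 - b * (mC + ρ) * h) with hRh
  have hden : 0 < 1 - b * (mC + ρ) * h := by linarith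
  have hRh0 : 0 ≤ Rh := div_nonneg (by positivity) hden.le
  have hA0 : 0 ≤ A := (gronwallBound_nonneg_of_zero hδ hh).trans hA
  have hR0 : 0 ≤ R := by linarith [hRh0, hA0, hAA'.le]
  have hflow := plohner_flow_dense (𝕊 := 𝕊) (ε₀ := ε₀) (α := α) hKb hKa hε hω hb hmC hρC hE₀ hh hguard hB hx hC
    hclauses
  refine stepCert_of_flowTube_local (Start := PInPara Kb Ka ω x C r E₀) (Land := PInPara Kb Ka ω x' Cn r' E₁)
    (Tube := TubeL 𝕊 ε₀ α Kb Ka ω p b mC ρC E₀ Rh x C r)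
    (glo := fun i k => -(R * ω i k)) (ghi := fun i k => R * ω i k)
    hKb hKa hω (by positivity : 0 ≤ 2 * b * R) hδ hAA' hN (fun u _ q y hq hnear i k hk1 hk2 => ?_)
    (pfieldLipOn_ball hε hω hR0 hB) hdef hflow hA hH
    (fun y q hq hnear => hN' y (pinPara_of_near hω hKK hq hnear))
  have h1 := abs_le.mp (hq.1 i k hk1 hk2)
  have h2 := abs_le.mp (hnear i k hk1 hk2)
  have h3 : (Rh + A') * ω i k ≤ R * ω i k := mul_le_mul_of_nonneg_right hR (hω i k).le
  constructor <;> nlinarith [h1.1, h1.2, h2.1, h2.2, h3, (hω i k).le]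

end CertificateGlueOn

end Summit.NavierStokesRegularity.NavierStokesRegularity.Theorems

end
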